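import Mathlib
import Literature.Geometry.Symplectic.JHolomorphicMap
import Summits.SmoothPoincare4.SmoothPoincare4.Theorems.SullivanDualTameOrBrodyR4AprioriCalculus
import Summits.SmoothPoincare4.SmoothPoincare4.Theorems.SullivanDualTameOrBrodyR4AprioriEnergy
import Summits.SmoothPoincare4.SmoothPoincare4.Theorems.SullivanDualTameOrBrodyR4AprioriAlpha
import Summits.SmoothPoincare4.SmoothPoincare4.Theorems.SullivanDualTameOrBrodyR4StubH1Estimate
import Summits.SmoothPoincare4.SmoothPoincare4.Theorems.SullivanDualTameOrBrodyR4StubNormIteratedFDerivLe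

/-!
# Local step α of the elliptic bootstrapping for flat `J`-holomorphic discs in `ℝ⁴`

Helper file of the lead (c2) for line `Sketch` of the crux `WitnessCharge`
(stmt-SmoothPoincare4-7824, route SullivanDual), registered stub `helper_alphaLocal`.

It localises the landed theorem `Apriori.alpha` of the sibling crux `TameOrBrodyR4`
(`SullivanDualTameOrBrodyR4AprioriAlpha`): the global flat `J`-holomorphicity
`IsJHolomorphicFlat J g` is replaced by the equation `dg(z)(iζ) = J(g z) (dg(z) ζ)` on the open
disc `‖z‖ < 2` only, and the two abstract inequalities `h1`, `hB` of `alpha` are discharged by the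
landed stubs `stub_h1Estimate` (constant-coefficient `H¹` identity) and `stub_normIteratedFDerivLe`
(basis control of multilinear maps on `ℂⁿ`). The equation enters `alpha` only through the
commutator identity at points of the closed unit disc; here the global identity of functions
`∂₂ g = (J ∘ g) ∂₁ g` is replaced by an eventual equality near each point of the disc of radius `2`,
which suffices for the iterated derivatives (`Filter.EventuallyEq.iteratedFDeriv`). Conclusion, as
in `alpha`: with the orders `1 ≤ i ≤ n - 2` frozen on the disc of radius `ρ`,
`∫_{D_{ρ'}} ‖D^{n+1}g‖² ≤ C (1 + ∫_{D_ρ} ‖D^{n-1}g‖⁴ + ∫_{D_ρ} ‖Dⁿg‖²)` with `C` independent of `g`.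
-/

noncomputable section

-- the registered namespace `Summit.SmoothPoincare4.SmoothPoincare4.…` repeats a component
set_option linter.dupNamespace false

open scoped ContDiff Topology Nat
open Filter Set Metric MeasureTheory Literature.Geometry.Symplectic
open Summit.SmoothPoincare4.SmoothPoincare4.Cruxes.TameOrBrodyR4.Sketch
open Summit.SmoothPoincare4.SmoothPoincare4.Cruxes.TameOrBrodyR4.Sketch.Apriori

namespace Summit.SmoothPoincare4.SmoothPoincare4.Theorems.WitnessCharge.PencilIncompleteness

/-- **The commutator identity, local version.** If the flat `J`-holomorphicity equation
`dg(y)(iζ) = J(g y) (dg(y) ζ)` holds on the open disc `‖y‖ < 2`, then at every point `z` of that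
disc, with `A = J ∘ g` and `p = ∂₁ g`, the word derivative `w = Dⁿg · m` satisfies
`∂₂ w (z) - A(z) (∂₁ w (z)) = (Dⁿ(A p)(z) - A(z) ∘ Dⁿp(z))(m)` (the functions `∂₂ g` and
`(J ∘ g) ∂₁ g` agree near `z`, hence so do their iterated derivatives at `z`). -/
theorem commutator_identity_local
    {J : EuclideanSpace ℝ (Fin 4) → EuclideanSpace ℝ (Fin 4) →L[ℝ] EuclideanSpace ℝ (Fin 4)}
    {g : ℂ → EuclideanSpace ℝ (Fin 4)} (hg : ContDiff ℝ ∞ g)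
    (hgJ : ∀ z : ℂ, ‖z‖ < 2 → ∀ ζ : ℂ, fderiv ℝ g z (Complex.I * ζ) = J (g z) (fderiv ℝ g z ζ))
    (n : ℕ) (m : Fin n → ℂ) {z : ℂ} (hz : ‖z‖ < 2) :
    fderiv ℝ (iteratedFDeriv ℝ n g · m) z Complex.I -
        J (g z) (fderiv ℝ (iteratedFDeriv ℝ n g · m) z 1) =
      (iteratedFDeriv ℝ n (fun y => J (g y) (fderiv ℝ g y 1)) z -
        (J (g z)).compContinuousMultilinearMap (iteratedFDeriv ℝ n (fderiv ℝ g · 1) z)) m := by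
  have hI := congrFun (fderiv_iteratedFDeriv_apply_comm hg Complex.I n m) z
  have h1 := congrFun (fderiv_iteratedFDeriv_apply_comm hg 1 n m) z
  -- the equation in word form `∂₂ g = (J ∘ g) ∂₁ g`, near `z`
  have hloc : (fderiv ℝ g · Complex.I) =ᶠ[𝓝 z] fun y => J (g y) (fderiv ℝ g y 1) := by
    refine Filter.eventuallyEq_of_mem (isOpen_ball.mem_nhds (mem_ball_zero_iff.mpr hz)) ?_
    intro y hy
    have h := hgJ y (mem_ball_zero_iff.mp hy) 1
    rw [mul_one] at h
    exact h
  have hit : iteratedFDeriv ℝ n (fderiv ℝ g · Complex.I) z =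
      iteratedFDeriv ℝ n (fun y => J (g y) (fderiv ℝ g y 1)) z :=
    (hloc.iteratedFDeriv ℝ n).eq_of_nhds
  rw [hI, h1, hit, sub_apply, ContinuousLinearMap.compContinuousMultilinearMap_coe,
    Function.comp_apply]

/-- **The pointwise source bound, local version.** For the source `∂₂w_L - (J∘g) ∂₁w_L` of a word
derivative `w_L = Dⁿg · e_L` at a point `z` of the open disc of radius `2` on which the flat
`J`-holomorphicity equation holds: local commutator identity + the landed bound `source_le`. -/
theorem source_pointwise_local
    {J : EuclideanSpace ℝ (Fin 4) → EuclideanSpace ℝ (Fin 4) →L[ℝ] EuclideanSpace ℝ (Fin 4)}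
    {g : ℂ → EuclideanSpace ℝ (Fin 4)} (hJs : ContDiff ℝ ∞ J) (hg : ContDiff ℝ ∞ g)
    (hgJ : ∀ z : ℂ, ‖z‖ < 2 → ∀ ζ : ℂ, fderiv ℝ g z (Complex.I * ζ) = J (g z) (fderiv ℝ g z ζ))
    {n : ℕ} (hn : 1 ≤ n) {M S : ℝ} (hS : 2 ≤ S) (L : Fin n → Fin 2) {z : ℂ} (hz : ‖z‖ < 2)
    (hM : ∀ i, i ≤ n → ‖iteratedFDeriv ℝ i J (g z)‖ ≤ M) (h1 : ‖fderiv ℝ g z‖ ≤ 2)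
    (hlow : ∀ i, 1 ≤ i → i + 2 ≤ n → ‖iteratedFDeriv ℝ i g z‖ ≤ S) :
    ‖fderiv ℝ (iteratedFDeriv ℝ n g · (fun j => ![(1 : ℂ), Complex.I] (L j))) z Complex.I -
        J (g z) (fderiv ℝ (iteratedFDeriv ℝ n g · (fun j => ![(1 : ℂ), Complex.I] (L j))) z 1)‖ ≤
      (∑ j ∈ Finset.range n,
        (n.choose (j + 1) : ℝ) * (j + 1)! * M * (S ^ (j + 1) + 1 + S ^ 2 + S) * (2 * S)) *
      (1 + ‖iteratedFDeriv ℝ (n - 1) g z‖ ^ 2 + ‖iteratedFDeriv ℝ n g z‖) := by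
  rw [commutator_identity_local hg hgJ n _ hz]
  refine (ContinuousMultilinearMap.le_opNorm _ _).trans ?_
  have hprod : ∏ j : Fin n, ‖(![(1 : ℂ), Complex.I] : Fin 2 → ℂ) (L j)‖ = 1 :=
    Finset.prod_eq_one fun j _ => norm_basis_eq_one (L j)
  rw [hprod, mul_one]
  have h1' : ‖iteratedFDeriv ℝ 1 g z‖ ≤ 2 := by rw [norm_iteratedFDeriv_one_eq]; exact h1
  exact source_le hJs hg hn hS z hM h1' hlow

/-- **Stub A1 (local step α).** `Apriori.alpha` of the `TameOrBrodyR4` chain with the global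
flat `J`-holomorphicity replaced by the equation on the open disc of radius `2` (the inequalities
`h1`, `hB` of `alpha` are the landed `stub_h1Estimate`, `stub_normIteratedFDerivLe`): with the
orders `1 ≤ i ≤ n - 2` frozen on the disc of radius `ρ` (`ρ` so small that `J ∘ g` is `ε`-close to
`J(g 0)` with `4(1 + M₀²)ε² ≤ 1`),
`∫_{D_{ρ'}} ‖D^{n+1}g‖² ≤ C (1 + ∫_{D_ρ} ‖D^{n-1}g‖⁴ + ∫_{D_ρ} ‖Dⁿg‖²)` with `C` independent of `g`. -/
theorem helper_alphaLocal :
    ∀ (J : EuclideanSpace ℝ (Fin 4) → EuclideanSpace ℝ (Fin 4) →L[ℝ] EuclideanSpace ℝ (Fin 4)),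
      ContDiff ℝ ∞ J → (∀ x v, J x (J x v) = -v) →
    ∀ (R₀ M₀ M₁ : ℝ), (∀ x : EuclideanSpace ℝ (Fin 4), ‖x‖ ≤ R₀ → ‖J x‖ ≤ M₀) →
      (∀ x : EuclideanSpace ℝ (Fin 4), ‖x‖ ≤ R₀ → ‖fderiv ℝ J x‖ ≤ M₁) →
    ∀ (n : ℕ), 1 ≤ n → ∀ (ρ' ρ : ℝ), 0 < ρ' → ρ' < ρ → ρ ≤ 1 →
      16 * (1 + M₀ ^ 2) * M₁ ^ 2 * ρ ^ 2 ≤ 1 → ∀ (S : ℝ),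
    ∃ C : ℝ, ∀ g : ℂ → EuclideanSpace ℝ (Fin 4), ContDiff ℝ ∞ g →
      (∀ z : ℂ, ‖z‖ < 2 → ∀ ζ : ℂ, fderiv ℝ g z (Complex.I * ζ) = J (g z) (fderiv ℝ g z ζ)) →
      (∀ z : ℂ, ‖z‖ ≤ 1 → ‖g z‖ ≤ R₀) → (∀ z : ℂ, ‖z‖ ≤ 1 → ‖fderiv ℝ g z‖ ≤ 2) →
      (∀ i, 1 ≤ i → i + 2 ≤ n → ∀ z : ℂ, ‖z‖ ≤ ρ → ‖iteratedFDeriv ℝ i g z‖ ≤ S) →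
      ∫ z in Metric.closedBall (0 : ℂ) ρ', ‖iteratedFDeriv ℝ (n + 1) g z‖ ^ 2 ≤
        C * (1 + (∫ z in Metric.closedBall (0 : ℂ) ρ, ‖iteratedFDeriv ℝ (n - 1) g z‖ ^ 4) +
          ∫ z in Metric.closedBall (0 : ℂ) ρ, ‖iteratedFDeriv ℝ n g z‖ ^ 2) := by
  intro J hJs hJ2 R₀ M₀ M₁ hM₀ hM₁ n hn ρ' ρ hρ' hρ'ρ hρ1 hρδ S
  -- degenerate case `R₀ < 0`: the hypotheses on `g` are contradictory
  rcases lt_or_ge R₀ 0 with hR | hR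
  · refine ⟨0, fun g _ _ hg0 _ _ => ?_⟩
    exact absurd ((norm_nonneg (g 0)).trans (hg0 0 (by simp))) (not_le.mpr hR)
  -- constants independent of `g`
  obtain ⟨M, hM⟩ := exists_bound_iteratedFDeriv hJs R₀ n
  have hM0 : 0 ≤ M := (norm_nonneg _).trans (hM 0 (Nat.zero_le _) 0 (by simpa using hR))
  have hS' : (2 : ℝ) ≤ max S 2 := le_max_right _ _
  have hS'0 : (0 : ℝ) ≤ max S 2 := zero_le_two.trans hS'
  obtain ⟨Cs, hCs_def⟩ : ∃ Cs : ℝ, Cs = ∑ j ∈ Finset.range n, (n.choose (j + 1) : ℝ) * (j + 1)! * M *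
      ((max S 2) ^ (j + 1) + 1 + (max S 2) ^ 2 + max S 2) * (2 * max S 2) := ⟨_, rfl⟩
  have hCs : 0 ≤ Cs := by rw [hCs_def]; exact srcConst_nonneg n hM0 hS'0
  let χ : ContDiffBump (0 : ℂ) := ⟨(2 * ρ' + ρ) / 3, (ρ' + 2 * ρ) / 3, by linarith, by linarith⟩
  have hχIn : ρ' < χ.rIn := by show ρ' < (2 * ρ' + ρ) / 3; linarith
  have hχOut : χ.rOut < ρ := by show (ρ' + 2 * ρ) / 3 < ρ; linarith
  have hχc : ContDiff ℝ ∞ (χ : ℂ → ℝ) := χ.contDiff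
  have hχs : HasCompactSupport (χ : ℂ → ℝ) := χ.hasCompactSupport
  obtain ⟨Cχ, hCχ⟩ : ∃ C, ∀ z, ‖fderiv ℝ (χ : ℂ → ℝ) z‖ ≤ C :=
    (hχs.fderiv (𝕜 := ℝ)).exists_bound_of_continuous (hχc.continuous_fderiv (by simp))
  have hCχ0 : 0 ≤ Cχ := (norm_nonneg _).trans (hCχ 0)
  have hCχv : ∀ z v, ‖fderiv ℝ (χ : ℂ → ℝ) z v‖ ≤ Cχ * ‖v‖ := fun z v =>
    (ContinuousLinearMap.le_opNorm _ _).trans (mul_le_mul_of_nonneg_right (hCχ z) (norm_nonneg _))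
  have hχ1 : ∀ z, |(χ : ℂ → ℝ) z| ≤ 1 := fun z => by
    rw [abs_of_nonneg χ.nonneg]; exact χ.le_one
  have hsuppχ : ∀ z ∈ tsupport (χ : ℂ → ℝ), ‖z‖ ≤ ρ := by
    intro z hz
    rw [χ.tsupport_eq] at hz
    exact (mem_closedBall_zero_iff.mp hz).trans hχOut.le
  obtain ⟨V, hV⟩ : ∃ V : ℝ, V = (volume (closedBall (0 : ℂ) ρ)).toReal := ⟨_, rfl⟩
  have hV0 : 0 ≤ V := by rw [hV]; exact ENNReal.toReal_nonneg
  have hM₀0 : 0 ≤ M₀ := (norm_nonneg _).trans (hM₀ 0 (by simpa using hR))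
  obtain ⟨K, hK⟩ : ∃ K : ℝ, K = 4 * (1 + M₀ ^ 2) * (6 * Cs ^ 2 * (V + 1) +
      2 * Cχ ^ 2 * (1 + M₀) ^ 2) := ⟨_, rfl⟩
  have hK0 : 0 ≤ K := by rw [hK]; positivity
  refine ⟨(2 : ℝ) ^ (n + 1) * 2 ^ (n + 1) * K, fun g hg hgJ hg0 hg1 hlow => ?_⟩
  -- abbreviations for the fixed map `g`
  have hac : ∀ k, Continuous fun z => ‖iteratedFDeriv ℝ k g z‖ := fun k =>
    (hg.continuous_iteratedFDeriv (m := k) (by exact_mod_cast le_top)).norm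
  have hA : Continuous fun z => J (g z) := hJs.continuous.comp hg.continuous
  have hA₀2 : ∀ v, J (g 0) (J (g 0) v) = -v := hJ2 (g 0)
  have hA₀n : ‖J (g 0)‖ ≤ M₀ := hM₀ _ (hg0 0 (by simp))
  have hAz : ∀ z : ℂ, ‖z‖ ≤ ρ → ‖J (g z)‖ ≤ M₀ := fun z hz => hM₀ _ (hg0 z (hz.trans hρ1))
  -- freezing: `‖J(g z) - J(g 0)‖ ≤ ε := 2 M₁ ρ` on the support of `χ`
  have hM₁0 : 0 ≤ M₁ := (norm_nonneg (fderiv ℝ J (g 0))).trans (hM₁ _ (hg0 0 (by simp)))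
  have hρ0 : 0 ≤ ρ := by linarith
  have hε : 4 * (1 + ‖J (g 0)‖ ^ 2) * (2 * M₁ * ρ) ^ 2 ≤ 1 := by
    have h' : ‖J (g 0)‖ ^ 2 ≤ M₀ ^ 2 := pow_le_pow_left₀ (norm_nonneg _) hA₀n 2
    have : 4 * (1 + ‖J (g 0)‖ ^ 2) * (2 * M₁ * ρ) ^ 2 ≤ 4 * (1 + M₀ ^ 2) * (2 * M₁ * ρ) ^ 2 := by
      apply mul_le_mul_of_nonneg_right _ (sq_nonneg _); linarith
    nlinarith
  have hAε : ∀ z ∈ tsupport (χ : ℂ → ℝ), ‖J (g z) - J (g 0)‖ ≤ 2 * M₁ * ρ := by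
    intro z hz
    have hzρ := hsuppχ z hz
    have hz1 : ‖z‖ ≤ 1 := hzρ.trans hρ1
    have hgz : ‖g z - g 0‖ ≤ 2 * ‖z - 0‖ :=
      (convex_closedBall (0 : ℂ) 1).norm_image_sub_le_of_norm_fderiv_le
        (fun x _ => (hg.differentiable (by simp)) x)
        (fun x hx => hg1 x (mem_closedBall_zero_iff.mp hx))
        (by simp) (mem_closedBall_zero_iff.mpr hz1)
    have hJz : ‖J (g z) - J (g 0)‖ ≤ M₁ * ‖g z - g 0‖ :=
      (convex_closedBall (0 : EuclideanSpace ℝ (Fin 4)) R₀).norm_image_sub_le_of_norm_fderiv_le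
        (fun x _ => (hJs.differentiable (by simp)) x)
        (fun x hx => hM₁ x (mem_closedBall_zero_iff.mp hx))
        (mem_closedBall_zero_iff.mpr (hg0 0 (by simp))) (mem_closedBall_zero_iff.mpr (hg0 z hz1))
    rw [sub_zero] at hgz
    calc ‖J (g z) - J (g 0)‖ ≤ M₁ * (2 * ‖z‖) := hJz.trans (mul_le_mul_of_nonneg_left hgz hM₁0)
      _ ≤ M₁ * (2 * ρ) := by gcongr
      _ = 2 * M₁ * ρ := by ring
  -- integrals on the big disc
  obtain ⟨I4, hI4⟩ : ∃ I4 : ℝ, I4 = ∫ z in closedBall (0 : ℂ) ρ, ‖iteratedFDeriv ℝ (n - 1) g z‖ ^ 4 :=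
    ⟨_, rfl⟩
  obtain ⟨I2, hI2⟩ : ∃ I2 : ℝ, I2 = ∫ z in closedBall (0 : ℂ) ρ, ‖iteratedFDeriv ℝ n g z‖ ^ 2 :=
    ⟨_, rfl⟩
  have hI40 : 0 ≤ I4 := by rw [hI4]; exact integral_nonneg fun z => by positivity
  have hI20 : 0 ≤ I2 := by rw [hI2]; exact integral_nonneg fun z => by positivity
  rw [← hI4, ← hI2]
  -- the localized energy bound for every word of length `n`
  have key : ∀ L : Fin n → Fin 2,
      (∫ z, (‖fderiv ℝ (fun t => χ t • iteratedFDeriv ℝ n g t (fun j => ![(1 : ℂ), Complex.I] (L j))) z 1‖ ^ 2 +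
        ‖fderiv ℝ (fun t => χ t • iteratedFDeriv ℝ n g t (fun j => ![(1 : ℂ), Complex.I] (L j))) z
          Complex.I‖ ^ 2)) ≤ K * (1 + I4 + I2) := by
    intro L
    have hw : ContDiff ℝ ∞ (iteratedFDeriv ℝ n g · (fun j => ![(1 : ℂ), Complex.I] (L j))) :=
      contDiff_iteratedFDeriv_apply hg n _
    have hs : ∀ z : ℂ, ‖z‖ ≤ ρ →
        ‖fderiv ℝ (iteratedFDeriv ℝ n g · (fun j => ![(1 : ℂ), Complex.I] (L j))) z Complex.I -
          J (g z) (fderiv ℝ (iteratedFDeriv ℝ n g · (fun j => ![(1 : ℂ), Complex.I] (L j))) z 1)‖ ≤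
        Cs * (1 + ‖iteratedFDeriv ℝ (n - 1) g z‖ ^ 2 + ‖iteratedFDeriv ℝ n g z‖) := by
      intro z hz
      have hz1 : ‖z‖ ≤ 1 := hz.trans hρ1
      have hz2 : ‖z‖ < 2 := hz1.trans_lt one_lt_two
      rw [hCs_def]
      exact source_pointwise_local hJs hg hgJ hn hS' L hz2 (fun i hi => hM i hi _ (hg0 z hz1))
        (hg1 z hz1) (fun i hi1 hi2 => (hlow i hi1 hi2 z hz).trans (le_max_left _ _))
    have hword := alpha_word stub_h1Estimate (J (g 0)) hA₀2 (fun z => J (g z)) hA _ hw χ hχc hχs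
      (2 * M₁ * ρ) hε hAε hCs hM₀0 hsuppχ hχ1 hCχv hAz (fun z => ‖iteratedFDeriv ℝ (n - 1) g z‖)
      (fun z => ‖iteratedFDeriv ℝ n g z‖) (hac _) (hac _) (fun z => norm_nonneg _)
      (fun z => norm_iteratedFDeriv_apply_basis_le g n L z) hs
    rw [← hV, ← hI4, ← hI2] at hword
    rw [hK]
    exact hword.trans (alpha_const_compare (norm_nonneg _) hA₀n hV0 hI40 hI20)
  -- the left-hand side: `a_{n+1}² ≤ 2^{n+1} ∑_{L'} (‖∂₁(χ w_{tail L'})‖² + ‖∂₂(χ w_{tail L'})‖²)` on the small disc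
  have hLHS : ∀ z ∈ closedBall (0 : ℂ) ρ', ‖iteratedFDeriv ℝ (n + 1) g z‖ ^ 2 ≤ (2 : ℝ) ^ (n + 1) *
      ∑ L' : Fin (n + 1) → Fin 2,
        (‖fderiv ℝ (fun t => χ t • iteratedFDeriv ℝ n g t (fun j => ![(1 : ℂ), Complex.I] (Fin.tail L' j))) z 1‖ ^ 2 +
         ‖fderiv ℝ (fun t => χ t • iteratedFDeriv ℝ n g t (fun j => ![(1 : ℂ), Complex.I] (Fin.tail L' j))) z
           Complex.I‖ ^ 2) := by
    intro z hz
    have hzIn : z ∈ ball (0 : ℂ) χ.rIn :=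
      mem_ball_zero_iff.mpr ((mem_closedBall_zero_iff.mp hz).trans_lt hχIn)
    refine (sq_norm_le_of_basis stub_normIteratedFDerivLe (n + 1) (iteratedFDeriv ℝ (n + 1) g z)).trans ?_
    refine mul_le_mul_of_nonneg_left (Finset.sum_le_sum fun L' _ => ?_) (pow_nonneg zero_le_two _)
    have hsucc := iteratedFDeriv_succ_apply_eq_fderiv hg n (fun j => ![(1 : ℂ), Complex.I] (L' j)) z
    have htail : (Fin.tail fun j => (![(1 : ℂ), Complex.I] : Fin 2 → ℂ) (L' j)) =
        fun j => ![(1 : ℂ), Complex.I] (Fin.tail L' j) := rfl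
    rw [htail] at hsucc
    rw [hsucc, ← fderiv_smul_eq_of_mem
      (w := (iteratedFDeriv ℝ n g · (fun j => ![(1 : ℂ), Complex.I] (Fin.tail L' j)))) hzIn]
    rcases Fin.eq_zero_or_eq_succ (L' 0) with h0 | ⟨j, hj⟩
    · simp only [h0, Matrix.cons_val_zero]
      exact le_add_of_nonneg_right (sq_nonneg _)
    · simp only [hj, Fin.eq_zero j, Matrix.cons_val_succ, Matrix.cons_val_zero]
      exact le_add_of_nonneg_left (sq_nonneg _)
  -- integrability of the localized energy densities
  have hG_int : ∀ L' : Fin (n + 1) → Fin 2, Integrable (fun z =>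
      ‖fderiv ℝ (fun t => χ t • iteratedFDeriv ℝ n g t (fun j => ![(1 : ℂ), Complex.I] (Fin.tail L' j))) z 1‖ ^ 2 +
      ‖fderiv ℝ (fun t => χ t • iteratedFDeriv ℝ n g t (fun j => ![(1 : ℂ), Complex.I] (Fin.tail L' j))) z
        Complex.I‖ ^ 2) := by
    intro L'
    have hW : ContDiff ℝ ∞ (fun t => χ t • iteratedFDeriv ℝ n g t (fun j => ![(1 : ℂ), Complex.I] (Fin.tail L' j))) :=
      hχc.smul (contDiff_iteratedFDeriv_apply hg n _)
    have hWc : HasCompactSupport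
        (fun t => χ t • iteratedFDeriv ℝ n g t (fun j => ![(1 : ℂ), Complex.I] (Fin.tail L' j))) :=
      hχs.smul_right
    have hc1 := (hW.continuous_fderiv (by simp)).clm_apply (continuous_const (y := (1 : ℂ)))
    have hcI := (hW.continuous_fderiv (by simp)).clm_apply (continuous_const (y := Complex.I))
    refine ((hc1.norm.pow 2).add (hcI.norm.pow 2)).integrable_of_hasCompactSupport ?_
    exact hasCompactSupport_of_eq_zero hWc fun z hz => by
      simp [fderiv_eq_zero_of_notMem_tsupport hz]
  have hcard : ((Finset.univ : Finset (Fin (n + 1) → Fin 2)).card : ℝ) = 2 ^ (n + 1) := by simp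
  calc ∫ z in closedBall (0 : ℂ) ρ', ‖iteratedFDeriv ℝ (n + 1) g z‖ ^ 2
      ≤ ∫ z in closedBall (0 : ℂ) ρ', (2 : ℝ) ^ (n + 1) * ∑ L' : Fin (n + 1) → Fin 2,
          (‖fderiv ℝ (fun t => χ t • iteratedFDeriv ℝ n g t (fun j => ![(1 : ℂ), Complex.I] (Fin.tail L' j))) z 1‖ ^ 2 +
           ‖fderiv ℝ (fun t => χ t • iteratedFDeriv ℝ n g t (fun j => ![(1 : ℂ), Complex.I] (Fin.tail L' j))) z
             Complex.I‖ ^ 2) := by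
        refine setIntegral_mono_on (integrableOn_closedBall_of_continuous ((hac _).pow 2) 0 ρ') ?_
          measurableSet_closedBall hLHS
        exact ((integrable_finsetSum _ fun L' _ => hG_int L').const_mul _).integrableOn
    _ = (2 : ℝ) ^ (n + 1) * ∑ L' : Fin (n + 1) → Fin 2, ∫ z in closedBall (0 : ℂ) ρ',
          (‖fderiv ℝ (fun t => χ t • iteratedFDeriv ℝ n g t (fun j => ![(1 : ℂ), Complex.I] (Fin.tail L' j))) z 1‖ ^ 2 +
           ‖fderiv ℝ (fun t => χ t • iteratedFDeriv ℝ n g t (fun j => ![(1 : ℂ), Complex.I] (Fin.tail L' j))) z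
             Complex.I‖ ^ 2) := by
        rw [integral_const_mul, integral_finsetSum _ fun L' _ => (hG_int L').integrableOn]
    _ ≤ (2 : ℝ) ^ (n + 1) * ∑ L' : Fin (n + 1) → Fin 2, K * (1 + I4 + I2) := by
        refine mul_le_mul_of_nonneg_left (Finset.sum_le_sum fun L' _ => ?_) (pow_nonneg zero_le_two _)
        exact (setIntegral_le_integral (hG_int L') (Filter.Eventually.of_forall fun z =>
          add_nonneg (sq_nonneg _) (sq_nonneg _))).trans (key (Fin.tail L'))
    _ = (2 : ℝ) ^ (n + 1) * 2 ^ (n + 1) * K * (1 + I4 + I2) := by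
        rw [Finset.sum_const, Finset.card_univ, ← Finset.card_univ, nsmul_eq_mul, hcard]; ring

end Summit.SmoothPoincare4.SmoothPoincare4.Theorems.WitnessCharge.PencilIncompleteness
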